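import Summits.QuantumFields.YangMills.Theorems.CovariantDischargeUniformFluxLetters
import Literature.MathematicalPhysics.QuantumFieldTheory.Balaban1983to89.T3UnitLawDensityEML
import HarnessLib

/-!
# The uniform flux-sector configuration keeps its SHAPE under Bałaban's (0.4)-shaped block averaging: constant curvature `L^{2k}α`
# at height `k`, hence EXACTLY FLAT at every wrap-around height — the kernel half of the located corner of `stub_sandwichSweepGap`

Cell `ym3-torus` (YM ladder rung R3 = continuum SU(2) Yang–Mills on the three-torus — a RUNG, NOT the Clay problem), width seat
`ym3-torus-px8` gen 6; crux `UnitScaleTilt.HistoryTailL` (stmt-QuantumFields-19936), registered skeleton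
`Cruxes/HistoryTailL/Lines/sandwich_discharge.lean` (planner ym-r3-idea-2 g13), `--supports` only (helper; ★★OWNER RULING №25 (d)).
NEGATIVE KNOWLEDGE, by kernel, for BOTH roads on this crux (the LEAD's rev-0 hazard `HAZARD-HGap-uniform-w1g6` §2 asserted the embedding
of the uniform-flux witness into Bałaban's averages on paper; the LOCATE `LOCATE-SWGAP-px8g6.md` (19936 evidence #53) found that the same
witness, with level-`j` angle `2π/L^{2t}`, passes the COARSER conjunct of the sandwich event trivially above height `j + t` by lattice
wrap-around — this file proves exactly that mechanism):

* §1 AFFINE abelian configurations along a unit vector `ω`: bond phases `c_μ + [μ = μ₁]·α·(x μ₀).val` (constant curvature `α` in the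
  `(μ₀,μ₁)`-plane, seam-free because `αN ∈ 2πℤ`): their plaquettes are EXACTLY `exp(±ι αω)` on the `(μ₀,μ₁)`-plaquettes and `1`
  elsewhere (`plaqHol_affine`), their straight block transports are phases with slope `L²α` (`axialAvg_affine`), their (0.4) loop
  families depend only on the DIRECTION of the coarse bond (`loopHol_affine_eq` — closed words + translation invariance mod `N`), hence so
  does the correction factor (`corr_affine_eq`), which moreover LIES ON THE TORUS (`corr_affine_mem`: by (0.6) the small-loop average of a
  family commuting with the torus commutes with the torus — the ONLY property of the small-loop average used, so every `LoopAverage ℰ`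
  is covered — and the centraliser of the torus is the torus); so ONE AVERAGING STEP MAPS AFFINE TO AFFINE WITH SLOPE `L²α` (`avgFun_affine`).
* §2 the tower: `Ū^k = (blockAvg ℰ)^k V` is affine with slope `L^{2k}α` at every height `k ≤ m + K` (`iter_affine`); consequences
  `dist1_plaqHol_iter_le` (`≤ 2|sin(L^{2k}α/2)|`), `plaqHol_iter_eq`, and ★`plaqHol_iter_eq_one`: at every height with `L^{2k}α ∈ 2πℤ`
  EVERY plaquette of `Ū^k` is EXACTLY `1`.
* §3 ★★`exists_uniformFlux_tower` / `exists_uniformFlux_tower_ℰp`: for a `T3Family` member `K`, a height `j` and a wrap distance `t` with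
  `2(j+t) ≤ m + K`, the uniform flux-sector configuration (`α = 2π/L^{2(j+t)}` in the `(e₀,e₁)`-plane along `e₀`) has (i) all plaquettes of
  `Ū^k` within `2|sin(π L^{2k}/L^{2(j+t)})|` of `1` for every `k ≤ m + K` (so every FINER conjunct whose threshold exceeds this holds),
  (ii) level-`j` `(e₀,e₁)`-plaquettes EXACTLY `exp(ι (2π/L^{2t}) e₀)` (the window datum), (iii) EVERY plaquette of `Ū^k` EXACTLY `1` for
  ALL `j + t ≤ k ≤ m + K` — the coarser conjunct of the sandwich event above `j + t` is passed for EVERY positive threshold, whatever `Λ`.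
  Together with ✓`CovariantDischargeSweepNoGain` (every exact lattice 2-form has zero total flux, so no small sweep lowers the action of a
  uniform flux) this is the kernel content of «exact critical points inside the sandwich event in the registered small regime».

WHAT THIS IS NOT.  The window/threshold ARITHMETIC of the memo (which `b` puts the witness in the event for given `L, Λ`) is not typed here
(it is real-number bookkeeping over `θBal`); nothing of `stub_sandwichSweepGap` (whose `Ψ′` ranges over arbitrary measurable bijections) is
refuted by kernel; nothing of the crux `HistoryTailL`, the rung R3, d = 4, a continuum limit or a mass gap is proved.  YM₃ on T³ is rung R3 of the
programme, NOT the Clay problem.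
References: T. Bałaban, CMP **109** (1987) 249–301 [Balaban1987RG1] ((0.4)–(0.7), (0.11) p.253); CMP **102** (1985) 255–275 [Balaban1985UV3]
((7) p.257, the small-field history whose coarser conjunct is at issue).  Everything here is elementary algebra over those definitions ([folklore]).
-/

noncomputable section

open scoped BigOperators Real Quaternion
open NormedSpace

namespace Summit.QuantumFields.YangMills.Theorems.CovariantDischargeUniformFluxAverages

open Literature.MathematicalPhysics.QuantumFieldTheory.Balaban1983to89
open Literature.MathematicalPhysics.QuantumLattice (su2Quat quatToSU2 quatToSU2_su2Quat norm_su2Quat su2Quat_ne_zero)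
open T4CubeChartGnomonic (SU2)
open T4HaarSU2ExpChart (imQuat imQuat_apply exp_imQuat_smul expPoint su2Quat_expPoint expPoint_zero)
open T4HaarSU2Translate (su2Quat_mul su2Quat_one)
open T4ExpWindowSmallField (dist1_expPoint_eq)
open T4Continuum (Letter LStep walk walkEnd holAt netDisp holAt_nil holAt_cons netDisp_cons)
open T4WilsonGaugeFlatDirection (su2Quat_injective)
open Summit.QuantumFields.YangMills.Theorems.CovariantDischargeUniformFluxLetters

/-! ## §1 AFFINE abelian configurations: constant curvature `α` in the `(μ₀, μ₁)`-plane along the axis `ω` -/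

section Affine

variable {P : Params} {j : ℕ} {ω : EuclideanSpace ℝ (Fin 3)} {μ₀ μ₁ : Fin P.d} {α : ℝ} {c : Fin P.d → ℝ}
  {U : GaugeField P j SU2}

/-- **PLAQUETTES OF AN AFFINE CONFIGURATION**: constant curvature `exp(ι αω)` on the `(μ₀,μ₁)`-plaquettes (`exp(−ι αω)` if the
lattice orders the pair the other way), `1` on all others; the seam of the integer labels is invisible because `αN ∈ 2πℤ`. [folklore] -/
theorem plaqHol_affine (hω : ‖ω‖ = 1) (hN : ∃ n : ℤ, α * (P.sitesPerDir j : ℝ) = 2 * π * n)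
    (hU : ∀ b : PBond P j, U b = expPoint ((c b.dir + if b.dir = μ₁ then α * ((b.src μ₀).val : ℝ) else 0) • ω))
    (p : Plaq P j) :
    GaugeField.plaqHol U p =
      if p.μ = μ₀ ∧ p.ν = μ₁ then expPoint (α • ω) else if p.μ = μ₁ ∧ p.ν = μ₀ then expPoint ((-α) • ω) else 1 := by
  obtain ⟨n, hn⟩ := hN
  -- the integer label of `z + 1` is `val z + 1` up to a multiple of `N`
  have hstep : ∀ z : ZMod (P.sitesPerDir j), ∃ m : ℤ, ((z + 1).val : ℝ) - (z.val : ℝ) = 1 + (P.sitesPerDir j : ℝ) * m := by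
    intro z
    have hd : (P.sitesPerDir j : ℤ) ∣ ((z + 1).val : ℤ) - (z.val : ℤ) - 1 := by
      rw [← ZMod.intCast_zmod_eq_zero_iff_dvd]; push_cast; simp
    obtain ⟨m, hm⟩ := hd
    exact ⟨m, by exact_mod_cast (show ((z + 1).val : ℤ) - (z.val : ℤ) = 1 + (P.sitesPerDir j : ℤ) * m by linarith)⟩
  have hsh0 : ∀ (x : Site P j) (κ : Fin P.d), κ ≠ μ₀ → (x.shift κ) μ₀ = x μ₀ := fun x κ hκ => by
    simp [Site.shift, Function.update_of_ne (Ne.symm hκ)]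
  have hsh1 : ∀ x : Site P j, (x.shift μ₀) μ₀ = x μ₀ + 1 := fun x => by simp [Site.shift]
  unfold GaugeField.plaqHol
  rw [hU, hU, hU, hU, ← expPoint_neg_smul, ← expPoint_neg_smul, ← expPoint_add_smul, ← expPoint_add_smul,
    ← expPoint_add_smul]
  by_cases hν : p.ν = μ₁
  · have hμ : p.μ ≠ μ₁ := fun h => (lt_irrefl _ : ¬ p.μ < p.μ) (by simpa [h, hν] using p.hμν)
    simp only [if_pos hν, if_neg hμ]
    by_cases hμ0 : p.μ = μ₀
    · rw [if_pos ⟨hμ0, hν⟩]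
      obtain ⟨m, hm⟩ := hstep (p.src μ₀)
      rw [hμ0, hsh1]
      refine expPoint_smul_eq_of_sub_eq hω (n * m) ?_
      have : α * (((p.src μ₀ + 1).val : ℝ) - ((p.src μ₀).val : ℝ)) = α + 2 * π * n * m := by
        rw [hm, mul_add, mul_one, ← mul_assoc, hn]
      push_cast; linarith
    · rw [if_neg (fun h => hμ0 h.1), if_neg (fun h => hμ h.1), hsh0 p.src p.μ hμ0, ← expPoint_zero_smul ω]
      congr 1; ring
  · by_cases hμ : p.μ = μ₁
    · simp only [if_pos hμ, if_neg hν]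
      by_cases hν0 : p.ν = μ₀
      · rw [if_neg (fun h => hν h.2), if_pos ⟨hμ, hν0⟩]
        obtain ⟨m, hm⟩ := hstep (p.src μ₀)
        rw [hν0, hsh1]
        refine expPoint_smul_eq_of_sub_eq hω (-(n * m)) ?_
        have : α * (((p.src μ₀ + 1).val : ℝ) - ((p.src μ₀).val : ℝ)) = α + 2 * π * n * m := by
          rw [hm, mul_add, mul_one, ← mul_assoc, hn]
        push_cast; linarith
      · rw [if_neg (fun h => hν h.2), if_neg (fun h => hν0 h.2), hsh0 p.src p.ν hν0, ← expPoint_zero_smul ω]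
        congr 1; ring
    · simp only [if_neg hμ, if_neg hν]
      rw [if_neg (fun h => hν h.2), if_neg (fun h => hμ h.1), ← expPoint_zero_smul ω]
      congr 1; ring

/-- Hence every plaquette of an affine configuration is within `2|sin(α/2)|` of `1`. [folklore] -/
theorem dist1_plaqHol_affine (hω : ‖ω‖ = 1) (hN : ∃ n : ℤ, α * (P.sitesPerDir j : ℝ) = 2 * π * n)
    (hU : ∀ b : PBond P j, U b = expPoint ((c b.dir + if b.dir = μ₁ then α * ((b.src μ₀).val : ℝ) else 0) • ω))
    (p : Plaq P j) : dist1 (GaugeField.plaqHol U p) ≤ 2 * |Real.sin (α / 2)| := by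
  rw [plaqHol_affine hω hN hU p]
  split_ifs
  · rw [dist1_expPoint_smul hω]
  · rw [dist1_expPoint_smul hω, neg_div, Real.sin_neg, abs_neg]
  · rw [GaugeGroup.dist1_one]; positivity

/-- And at a WRAP-AROUND slope (`α ∈ 2πℤ`, so `exp(ι αω) = 1`) every plaquette variable IS `1`. [folklore] -/
theorem plaqHol_affine_eq_one (hω : ‖ω‖ = 1) (hN : ∃ n : ℤ, α * (P.sitesPerDir j : ℝ) = 2 * π * n)
    (hU : ∀ b : PBond P j, U b = expPoint ((c b.dir + if b.dir = μ₁ then α * ((b.src μ₀).val : ℝ) else 0) • ω))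
    (hα : ∃ k : ℤ, α = 2 * π * k) (p : Plaq P j) : GaugeField.plaqHol U p = 1 := by
  obtain ⟨k, hk⟩ := hα
  have h1 : expPoint (α • ω) = 1 := by rw [hk, expPoint_two_pi_mul_int_smul hω]
  rw [plaqHol_affine hω hN hU p]
  split_ifs
  · exact h1
  · rw [expPoint_neg_smul, h1, inv_one]
  · rfl

/-- **STRAIGHT BLOCK TRANSPORT OF AN AFFINE CONFIGURATION** (`Ū(c) = U(Γ_c)`, the `L` steps from the block centre): again a phase,
`L·(c_μ + [μ = μ₁]·α·(L·val(y μ₀) + (L−1)/2))` — slope `L²α` in the coarse label. [folklore] -/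
theorem axialAvg_affine (hj : j + 1 ≤ P.m + P.K) (h01 : μ₀ ≠ μ₁)
    (hU : ∀ b : PBond P j, U b = expPoint ((c b.dir + if b.dir = μ₁ then α * ((b.src μ₀).val : ℝ) else 0) • ω))
    (b : PBond P (j + 1)) :
    AveragingRT.axialAvg U b = expPoint ((P.L * (c b.dir +
      if b.dir = μ₁ then α * (((b.src μ₀).val * P.L + (P.L - 1) / 2 : ℕ) : ℝ) else 0)) • ω) := by
  rw [T4Continuum.axialAvg_eq_holAt_walk, holAt_eq_expPoint_sum _ hU, sum_phase_line h01, ← Site.val_emb hj b.src μ₀]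

/-- **THE (0.4) LOOP VARIABLES OF AN AFFINE CONFIGURATION DEPEND ONLY ON THE DIRECTION OF THE COARSE BOND** (the loop words are
closed, so the constant phases cancel and the area phase is translation invariant modulo `αN ∈ 2πℤ`). [folklore] -/
theorem loopHol_affine_eq (hω : ‖ω‖ = 1) (h01 : μ₀ ≠ μ₁) (hN : ∃ n : ℤ, α * (P.sitesPerDir j : ℝ) = 2 * π * n)
    (hU : ∀ b : PBond P j, U b = expPoint ((c b.dir + if b.dir = μ₁ then α * ((b.src μ₀).val : ℝ) else 0) • ω))
    {b b' : PBond P (j + 1)} (hdir : b.dir = b'.dir) :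
    BlockAveraging.loopHol U b = BlockAveraging.loopHol U b' := by
  obtain ⟨n, hn⟩ := hN
  funext i
  unfold BlockAveraging.loopHol
  rw [hdir, holAt_eq_expPoint_sum _ hU, holAt_eq_expPoint_sum _ hU, sum_phase_eq μ₀ μ₁ α c, sum_phase_eq μ₀ μ₁ α c,
    sum_walk_const, sum_walk_const]
  set w := T4Continuum.loopWord P.L b'.dir (BlockAveraging.off i.1) i.2.1 i.2.2 with hw
  have hcl : netDisp w μ₁ = 0 := T4Continuum.netDisp_loopWord _ _ _ _ _ _
  obtain ⟨m, hm⟩ := areaSumZ_sub_dvd μ₀ μ₁ h01 w hcl (emb b.src) (emb b'.src)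
  refine expPoint_smul_eq_of_sub_eq hω (n * m) ?_
  rw [add_sub_add_left_eq_sub, ← mul_sub, ← Int.cast_sub, hm]
  push_cast
  rw [← mul_assoc, hn]
  ring

/-- Every (0.4) loop variable of an affine configuration lies on the torus `θ ↦ exp(ι θω)`. [folklore] -/
theorem loopHol_affine_mem (hU : ∀ b : PBond P j, U b = expPoint ((c b.dir + if b.dir = μ₁ then α * ((b.src μ₀).val : ℝ) else 0) • ω))
    (b : PBond P (j + 1)) (i : BlockAveraging.Idx P) : ∃ θ : ℝ, BlockAveraging.loopHol U b i = expPoint (θ • ω) :=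
  ⟨_, holAt_eq_expPoint_sum _ hU _⟩

variable (ℰ : LoopAverage SU2)

/-- **THE CORRECTION FACTOR OF (0.4) DEPENDS ONLY ON THE DIRECTION** (guard and value are functions of the loop family). [folklore] -/
theorem corr_affine_eq (hω : ‖ω‖ = 1) (h01 : μ₀ ≠ μ₁) (hN : ∃ n : ℤ, α * (P.sitesPerDir j : ℝ) = 2 * π * n)
    (hU : ∀ b : PBond P j, U b = expPoint ((c b.dir + if b.dir = μ₁ then α * ((b.src μ₀).val : ℝ) else 0) • ω))
    {b b' : PBond P (j + 1)} (hdir : b.dir = b'.dir) :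
    BlockAveraging.corr ℰ U b = BlockAveraging.corr ℰ U b' := by
  unfold BlockAveraging.corr BlockAveraging.Small
  rw [loopHol_affine_eq hω h01 hN hU hdir]

/-- **THE CORRECTION FACTOR LIES ON THE TORUS** (`ω = e₀`): by (0.6) the small-loop average of a family commuting with the torus
commutes with the torus, and the centraliser of the torus in `SU(2)` is the torus; off the guard the factor is `1`. This is the
ONLY property of the small-loop average `ℰ` used — any `LoopAverage` will do. [cite: Balaban1987RG1, (0.6) p.253] -/
theorem corr_affine_mem (hω0 : ω = EuclideanSpace.single (0 : Fin 3) (1 : ℝ))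
    (hU : ∀ b : PBond P j, U b = expPoint ((c b.dir + if b.dir = μ₁ then α * ((b.src μ₀).val : ℝ) else 0) • ω))
    (b : PBond P (j + 1)) : ∃ θ : ℝ, BlockAveraging.corr ℰ U b = expPoint (θ • ω) := by
  subst hω0
  classical
  by_cases hS : BlockAveraging.Small ℰ U b
  · unfold BlockAveraging.corr
    rw [if_pos hS]
    set u : SU2 := expPoint ((π / 2) • EuclideanSpace.single (0 : Fin 3) (1 : ℝ)) with hu
    have hfix : (fun i => u * BlockAveraging.loopHol U b i * u⁻¹) = BlockAveraging.loopHol U b := by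
      funext i
      obtain ⟨θ, hθ⟩ := loopHol_affine_mem hU b i
      rw [hθ, hu, ← expPoint_neg_smul, ← expPoint_add_smul, ← expPoint_add_smul]
      congr 1; ring_nf
    have hconj := ℰ.avg_conj (BlockAveraging.loopHol U b) hS u
    rw [hfix] at hconj
    apply exists_eq_expPoint_of_commute
    rw [← hu]
    calc ℰ.avg (BlockAveraging.loopHol U b) * u = u * ℰ.avg (BlockAveraging.loopHol U b) * u⁻¹ * u := by rw [← hconj]
      _ = u * ℰ.avg (BlockAveraging.loopHol U b) := by rw [inv_mul_cancel_right]
  · refine ⟨0, ?_⟩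
    unfold BlockAveraging.corr
    rw [if_neg hS, expPoint_zero_smul]

/-- **ONE BAŁABAN AVERAGING STEP MAPS AFFINE TO AFFINE WITH SLOPE `L²α`** (`ω = e₀`, any small-loop average `ℰ`):
`Ū = corr·U(Γ_c)` is again constant-curvature abelian along `e₀`, with curvature `L²α` per coarse plaquette. [cite: Balaban1987RG1, (0.4) p.253] -/
theorem avgFun_affine (hω0 : ω = EuclideanSpace.single (0 : Fin 3) (1 : ℝ)) (hj : j + 1 ≤ P.m + P.K) (h01 : μ₀ ≠ μ₁)
    (hN : ∃ n : ℤ, α * (P.sitesPerDir j : ℝ) = 2 * π * n)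
    (hU : ∀ b : PBond P j, U b = expPoint ((c b.dir + if b.dir = μ₁ then α * ((b.src μ₀).val : ℝ) else 0) • ω)) :
    ∃ c' : Fin P.d → ℝ, ∀ b : PBond P (j + 1), BlockAveraging.avgFun ℰ U b =
      expPoint ((c' b.dir + if b.dir = μ₁ then (α * (P.L : ℝ) ^ 2) * ((b.src μ₀).val : ℝ) else 0) • ω) := by
  have hω : ‖ω‖ = 1 := by rw [hω0]; simp
  choose θ hθ using fun μ : Fin P.d => corr_affine_mem ℰ hω0 hU ⟨default, μ⟩
  refine ⟨fun μ => θ μ + P.L * c μ + (if μ = μ₁ then α * P.L * (((P.L - 1) / 2 : ℕ) : ℝ) else 0), fun b => ?_⟩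
  show BlockAveraging.corr ℰ U b * AveragingRT.axialAvg U b = _
  rw [corr_affine_eq ℰ hω h01 hN hU (show b.dir = (⟨default, b.dir⟩ : PBond P (j + 1)).dir from rfl), hθ,
    axialAvg_affine hj h01 hU, ← expPoint_add_smul]
  congr 1
  by_cases hb : b.dir = μ₁
  · simp only [hb, if_true]; push_cast; ring
  · simp only [hb, if_false]; ring


end Affine

/-! ## §2 The Bałaban tower of an affine configuration: slope `L^{2k}α` at height `k` -/

section Tower

variable {P : Params} {ω : EuclideanSpace ℝ (Fin 3)} {μ₀ μ₁ : Fin P.d} {α : ℝ} {c : Fin P.d → ℝ} {V : GaugeField P 0 SU2}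
  (ℰ : LoopAverage SU2)

/-- **THE ITERATED BLOCK AVERAGES OF AN AFFINE CONFIGURATION ARE AFFINE, WITH SLOPE `L^{2k}α` AT HEIGHT `k`** (and the flux
quantisation persists at every height of the standing range). [cite: Balaban1987RG1, (0.11) p.253] -/
theorem iter_affine (hω0 : ω = EuclideanSpace.single (0 : Fin 3) (1 : ℝ)) (h01 : μ₀ ≠ μ₁)
    (hV : ∀ b : PBond P 0, V b = expPoint ((c b.dir + if b.dir = μ₁ then α * ((b.src μ₀).val : ℝ) else 0) • ω))
    (hN : ∃ n : ℤ, α * (P.sitesPerDir 0 : ℝ) = 2 * π * n) :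
    ∀ k : ℕ, k ≤ P.m + P.K →
      (∃ ck : Fin P.d → ℝ, ∀ b : PBond P k, Averaging.iter (fun i => BlockAveraging.blockAvg (P := P) (j := i) ℰ) k V b =
          expPoint ((ck b.dir + if b.dir = μ₁ then (α * (P.L : ℝ) ^ (2 * k)) * ((b.src μ₀).val : ℝ) else 0) • ω)) ∧
        ∃ n : ℤ, (α * (P.L : ℝ) ^ (2 * k)) * (P.sitesPerDir k : ℝ) = 2 * π * n
  | 0, _ => by
    refine ⟨⟨c, fun b => ?_⟩, ?_⟩
    · rw [show Averaging.iter (fun i => BlockAveraging.blockAvg (P := P) (j := i) ℰ) 0 V = V from rfl, hV b]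
      simp
    · simpa using hN
  | k + 1, hk => by
    obtain ⟨⟨ck, hck⟩, hNk⟩ := iter_affine hω0 h01 hV hN k (by omega)
    obtain ⟨c', hc'⟩ := avgFun_affine ℰ hω0 hk h01 hNk hck
    refine ⟨⟨c', fun b => ?_⟩, ?_⟩
    · rw [show Averaging.iter (fun i => BlockAveraging.blockAvg (P := P) (j := i) ℰ) (k + 1) V =
          BlockAveraging.avgFun ℰ (Averaging.iter (fun i => BlockAveraging.blockAvg (P := P) (j := i) ℰ) k V) from rfl, hc' b]
      congr 3
      split_ifs
      · ring
      · rfl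
    · obtain ⟨n, hn⟩ := quant_succ hk hNk
      exact ⟨n, by rw [← hn]; ring⟩

/-- Hence, at every height `k` of the standing range, every plaquette of `Ū^k` is within `2|sin(L^{2k}α/2)|` of `1`, … [folklore] -/
theorem dist1_plaqHol_iter_le (hω0 : ω = EuclideanSpace.single (0 : Fin 3) (1 : ℝ)) (h01 : μ₀ ≠ μ₁)
    (hV : ∀ b : PBond P 0, V b = expPoint ((c b.dir + if b.dir = μ₁ then α * ((b.src μ₀).val : ℝ) else 0) • ω))
    (hN : ∃ n : ℤ, α * (P.sitesPerDir 0 : ℝ) = 2 * π * n) (k : ℕ) (hk : k ≤ P.m + P.K) (p : Plaq P k) :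
    dist1 (GaugeField.plaqHol (Averaging.iter (fun i => BlockAveraging.blockAvg (P := P) (j := i) ℰ) k V) p) ≤
      2 * |Real.sin (α * (P.L : ℝ) ^ (2 * k) / 2)| := by
  have hω : ‖ω‖ = 1 := by rw [hω0]; simp
  obtain ⟨⟨ck, hck⟩, hNk⟩ := iter_affine ℰ hω0 h01 hV hN k hk
  exact dist1_plaqHol_affine hω hNk hck p

/-- … the `(μ₀, μ₁)`-plaquettes are EXACTLY `exp(ι L^{2k}α ω)` (the others `1`), … [folklore] -/
theorem plaqHol_iter_eq (hω0 : ω = EuclideanSpace.single (0 : Fin 3) (1 : ℝ)) (h01 : μ₀ ≠ μ₁)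
    (hV : ∀ b : PBond P 0, V b = expPoint ((c b.dir + if b.dir = μ₁ then α * ((b.src μ₀).val : ℝ) else 0) • ω))
    (hN : ∃ n : ℤ, α * (P.sitesPerDir 0 : ℝ) = 2 * π * n) (k : ℕ) (hk : k ≤ P.m + P.K) (p : Plaq P k) :
    GaugeField.plaqHol (Averaging.iter (fun i => BlockAveraging.blockAvg (P := P) (j := i) ℰ) k V) p =
      if p.μ = μ₀ ∧ p.ν = μ₁ then expPoint ((α * (P.L : ℝ) ^ (2 * k)) • ω)
      else if p.μ = μ₁ ∧ p.ν = μ₀ then expPoint ((-(α * (P.L : ℝ) ^ (2 * k))) • ω) else 1 := by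
  have hω : ‖ω‖ = 1 := by rw [hω0]; simp
  obtain ⟨⟨ck, hck⟩, hNk⟩ := iter_affine ℰ hω0 h01 hV hN k hk
  exact plaqHol_affine hω hNk hck p

/-- … and **AT EVERY WRAP-AROUND HEIGHT (`L^{2k}α ∈ 2πℤ`) EVERY PLAQUETTE OF `Ū^k` IS EXACTLY `1`**. [folklore] -/
theorem plaqHol_iter_eq_one (hω0 : ω = EuclideanSpace.single (0 : Fin 3) (1 : ℝ)) (h01 : μ₀ ≠ μ₁)
    (hV : ∀ b : PBond P 0, V b = expPoint ((c b.dir + if b.dir = μ₁ then α * ((b.src μ₀).val : ℝ) else 0) • ω))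
    (hN : ∃ n : ℤ, α * (P.sitesPerDir 0 : ℝ) = 2 * π * n) (k : ℕ) (hk : k ≤ P.m + P.K)
    (hwrap : ∃ m : ℤ, α * (P.L : ℝ) ^ (2 * k) = 2 * π * m) (p : Plaq P k) :
    GaugeField.plaqHol (Averaging.iter (fun i => BlockAveraging.blockAvg (P := P) (j := i) ℰ) k V) p = 1 := by
  have hω : ‖ω‖ = 1 := by rw [hω0]; simp
  obtain ⟨⟨ck, hck⟩, hNk⟩ := iter_affine ℰ hω0 h01 hV hN k hk
  exact plaqHol_affine_eq_one hω hNk hck hwrap p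

end Tower

/-! ## §3 The uniform flux-sector configuration of the `K`-th approximation of a `T3Family` and its whole Bałaban tower -/

section T3

open T3ContinuumYM3Torus

variable (ℰ : LoopAverage SU2)

/-- **THE WRAP-AROUND CERTIFICATE.**  For a `T3Family` member `K`, a height `j` and a wrap distance `t` with `2(j+t) ≤ m + K`, the
UNIFORM FLUX-SECTOR CONFIGURATION `V` (axial labels: `V⟨x, e₁⟩ = exp(ι (2π/L^{2(j+t)})·x₀·e₀)`, all other bonds `1`) has, under the
tower of (0.4)-shaped block averagings `Ū^k = (blockAvg ℰ)^k V` of ANY small-loop average `ℰ` (in particular the printed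
`T3UnitLawDensityEML.ℰp`): (i) at every height `k ≤ m + K` all plaquette variables within `2|sin(π·L^{2k}/L^{2(j+t)})|` of `1`;
(ii) at the height `j` the `(e₀,e₁)`-plaquettes EXACTLY `exp(ι (2π/L^{2t}) e₀)`; (iii) at EVERY height `k ≥ j + t` ALL plaquette
variables EXACTLY `1` — the averaged field is FLAT there although the level-`j` field is not.  This is the configuration of the
LEAD's hazard `HAZARD-HGap-uniform-w1g6` §2 (global variant) embedded in the tree's own averages, and the kernel half of the located
corner of `stub_sandwichSweepGap` (cell bus 2026-08-29, 19936 evidence #53): with `φ_j = 2π/L^{2t}` the coarser conjunct of the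
sandwich event is passed trivially above `j + t`. [cite: Balaban1987RG1, (0.4) p.253; Balaban1985UV3, (7) p.257] -/
theorem exists_uniformFlux_tower (F : T3Family) (K j t : ℕ) (hjt : 2 * (j + t) ≤ F.m + K) :
    ∃ V : GaugeField (F.P K) 0 SU2,
      (∀ k, k ≤ F.m + K → ∀ p : Plaq (F.P K) k,
          dist1 (GaugeField.plaqHol (Averaging.iter (fun i => BlockAveraging.blockAvg (P := F.P K) (j := i) ℰ) k V) p) ≤
            2 * |Real.sin (π * (F.L : ℝ) ^ (2 * k) / (F.L : ℝ) ^ (2 * (j + t)))|) ∧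
      (∀ p : Plaq (F.P K) j, p.μ.val = 0 → p.ν.val = 1 →
          GaugeField.plaqHol (Averaging.iter (fun i => BlockAveraging.blockAvg (P := F.P K) (j := i) ℰ) j V) p =
            expPoint ((2 * π / (F.L : ℝ) ^ (2 * t)) • EuclideanSpace.single (0 : Fin 3) (1 : ℝ))) ∧
      (∀ k, j + t ≤ k → k ≤ F.m + K → ∀ p : Plaq (F.P K) k,
          GaugeField.plaqHol (Averaging.iter (fun i => BlockAveraging.blockAvg (P := F.P K) (j := i) ℰ) k V) p = 1) := by
  set μ₀ : Fin (F.P K).d := ⟨0, by simp⟩ with hμ₀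
  set μ₁ : Fin (F.P K).d := ⟨1, by simp⟩ with hμ₁
  have h01 : μ₀ ≠ μ₁ := by simp [hμ₀, hμ₁]
  set α : ℝ := 2 * π / (F.L : ℝ) ^ (2 * (j + t)) with hα
  have hL0 : (F.L : ℝ) ≠ 0 := by have := F.hL.2; positivity
  have hLK : ((F.P K).L : ℝ) = F.L := rfl
  have hmK : (F.P K).m + (F.P K).K = F.m + K := rfl
  -- the configuration
  refine ⟨fun b => expPoint (((fun _ : Fin (F.P K).d => (0 : ℝ)) b.dir +
      if b.dir = μ₁ then α * ((b.src μ₀).val : ℝ) else 0) • EuclideanSpace.single (0 : Fin 3) (1 : ℝ)), ?_⟩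
  have hV : ∀ b : PBond (F.P K) 0, (fun b : PBond (F.P K) 0 => expPoint (((fun _ : Fin (F.P K).d => (0 : ℝ)) b.dir +
      if b.dir = μ₁ then α * ((b.src μ₀).val : ℝ) else 0) • EuclideanSpace.single (0 : Fin 3) (1 : ℝ))) b =
      expPoint (((fun _ : Fin (F.P K).d => (0 : ℝ)) b.dir + if b.dir = μ₁ then α * ((b.src μ₀).val : ℝ) else 0) •
        EuclideanSpace.single (0 : Fin 3) (1 : ℝ)) := fun b => rfl
  -- flux quantisation at the finest level: `α·2L^{m+K} = 2π·2L^{m+K−2(j+t)}`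
  have hN : ∃ n : ℤ, α * ((F.P K).sitesPerDir 0 : ℝ) = 2 * π * n := by
    refine ⟨2 * (F.L : ℤ) ^ (F.m + K - 2 * (j + t)), ?_⟩
    have hs : (F.P K).sitesPerDir 0 = 2 * F.L ^ (F.m + K) := by simp [Params.sitesPerDir]
    rw [hs, hα]
    have hpow : (F.L : ℝ) ^ (F.m + K) = (F.L : ℝ) ^ (2 * (j + t)) * (F.L : ℝ) ^ (F.m + K - 2 * (j + t)) := by
      rw [← pow_add, Nat.add_sub_cancel' hjt]
    push_cast
    rw [hpow]
    field_simp
  have hslope : ∀ k : ℕ, α * ((F.P K).L : ℝ) ^ (2 * k) = 2 * π * (F.L : ℝ) ^ (2 * k) / (F.L : ℝ) ^ (2 * (j + t)) := by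
    intro k; rw [hLK, hα]; ring
  refine ⟨fun k hk p => ?_, fun p hp0 hp1 => ?_, fun k hk1 hk2 p => ?_⟩
  · have h := dist1_plaqHol_iter_le ℰ (c := fun _ => (0 : ℝ)) rfl h01 hV hN k (by rw [hmK]; exact hk) p
    rwa [hslope, show 2 * π * (F.L : ℝ) ^ (2 * k) / (F.L : ℝ) ^ (2 * (j + t)) / 2 =
      π * (F.L : ℝ) ^ (2 * k) / (F.L : ℝ) ^ (2 * (j + t)) by ring] at h
  · have hj : j ≤ (F.P K).m + (F.P K).K := by rw [hmK]; omega
    have h := plaqHol_iter_eq ℰ (c := fun _ => (0 : ℝ)) rfl h01 hV hN j hj p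
    have hpμ : p.μ = μ₀ := Fin.ext hp0
    have hpν : p.ν = μ₁ := Fin.ext hp1
    rw [h, if_pos ⟨hpμ, hpν⟩, hslope]
    congr 2
    have hp : (F.L : ℝ) ^ (2 * (j + t)) = (F.L : ℝ) ^ (2 * j) * (F.L : ℝ) ^ (2 * t) := by rw [← pow_add]; ring_nf
    rw [hp]
    field_simp
  · refine plaqHol_iter_eq_one ℰ (c := fun _ => (0 : ℝ)) rfl h01 hV hN k (by rw [hmK]; exact hk2)
      ⟨(F.L : ℤ) ^ (2 * k - 2 * (j + t)), ?_⟩ p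
    rw [hslope]
    have hpow : (F.L : ℝ) ^ (2 * k) = (F.L : ℝ) ^ (2 * (j + t)) * (F.L : ℝ) ^ (2 * k - 2 * (j + t)) := by
      rw [← pow_add]; congr 1; omega
    rw [hpow]
    push_cast
    field_simp

/-- The same, at the printed small-loop average `ℰp` of the route `T3UnitScaleTilt` (the letters of `stub_sandwichSweepGap`). [cite: Balaban1987RG1, (0.4) p.253] -/
theorem exists_uniformFlux_tower_ℰp (F : T3Family) (K j t : ℕ) (hjt : 2 * (j + t) ≤ F.m + K) :
    ∃ V : GaugeField (F.P K) 0 SU2,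
      (∀ k, k ≤ F.m + K → ∀ p : Plaq (F.P K) k,
          dist1 (GaugeField.plaqHol (Averaging.iter
            (fun i => BlockAveraging.blockAvg (P := F.P K) (j := i) T3UnitLawDensityEML.ℰp) k V) p) ≤
            2 * |Real.sin (π * (F.L : ℝ) ^ (2 * k) / (F.L : ℝ) ^ (2 * (j + t)))|) ∧
      (∀ p : Plaq (F.P K) j, p.μ.val = 0 → p.ν.val = 1 →
          GaugeField.plaqHol (Averaging.iter
            (fun i => BlockAveraging.blockAvg (P := F.P K) (j := i) T3UnitLawDensityEML.ℰp) j V) p =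
            expPoint ((2 * π / (F.L : ℝ) ^ (2 * t)) • EuclideanSpace.single (0 : Fin 3) (1 : ℝ))) ∧
      (∀ k, j + t ≤ k → k ≤ F.m + K → ∀ p : Plaq (F.P K) k,
          GaugeField.plaqHol (Averaging.iter
            (fun i => BlockAveraging.blockAvg (P := F.P K) (j := i) T3UnitLawDensityEML.ℰp) k V) p = 1) :=
  exists_uniformFlux_tower _ F K j t hjt

end T3

end Summit.QuantumFields.YangMills.Theorems.CovariantDischargeUniformFluxAverages

end
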